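import Summits.BirchSwinnertonDyer.BirchSwinnertonDyer.Theorems.ManinLocalTwoThreeCDivisionNodesOneToFive
import Literature.NumberTheory.EllipticCurves.PeriodLatticePresentationProofs
import Literature.NumberTheory.EllipticCurves.EichlerIntegralPolesProofs
import Literature.NumberTheory.EllipticCurves.WeierstrassPEichlerOrderProofs
import Literature.NumberTheory.EllipticCurves.ModularParametrizationDegreeProofs
import Literature.NumberTheory.EllipticCurves.ModularCurveKleinJ
import Literature.NumberTheory.EllipticCurves.ManinConstantGamma1ModularDegree
import HarnessLib

/-!
# Node (N6) of the `c`-division witness in RAW form: BOUNDED GROWTH AT EVERY CUSP (any `f ≠ 0`, any period pair `Λ`, any finite-index `Γ`)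
# (cell bsd-f2-manin, route `ManinLocalTwoThree`; cruxes C2 stmt-BirchSwinnertonDyer-22967 / C3 stmt-…-22968; lead p1 gen 19, an g44's node N6 `CDivGrowth`)

For `f ∈ S₂(Γ₀(N))`, `f ≠ 0`, a period pair `Λ`, a modular form `B_d ∈ M_w(Γ₀(N))` and a finite-index `Γ ≤ SL₂(ℤ)`: there is `a ≥ 2` such that every
`F : ℍ → ℂ` which is `Γ`-invariant of weight `w + 12a` and equals `℘_Λ(E_f)·(12·B_d·Δ^a)` off the poles satisfies, for EVERY `g ∈ SL₂(ℤ)`, an exponential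
growth bound high in the cusp `g·i∞` (in fact `F ∣ g → 0`).  Proof (template `isZeroAtImInfty_slash_of_presentation`, Literature
`PeriodLatticePresentationProofs`): coset representatives `R` of `Γ` (`exists_finset_mul_cover`), `a := 2 + Σ_{r ∈ R} (2m_r + 1)` with `m_r` the order at
`q_N = 0` of `V_r = 2πi∫(f ∣[2] r)`; for `g = γ·r`, `F ∣ g = F ∣ r = ℘_Λ(C_r + V_r)·Δ^a · 12·(B_d ∣[w] r)` high in the cusp (`exists_eichlerIntegral_smul_eq`,
`exists_forall_eichlerIntegral_smul_notMem`, `discriminant_apply_smul`), where `℘_Λ(C_r + V_r)·Δ^a → 0` (`IsCuspFunction.tendsto_weierstrassP_mul_pow_atImInfty`)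
and `B_d ∣[w] r` is bounded (`ModularFormClass.bdd_at_infty_slash`).  RAW form `growth_raw` (serves the `X₀(N)`-datum AND the `X₁(N)`-optimal datum alike;
p3 g18 lands an's typed node (N6) `CDivGrowth` for `X₀(N)`-data in `…CDivisionGrowth.lean` — this file carries only the raw and the `X₁(N)` forms).  No definitions, no sorry.  BSD / C2 / C3 are not proved by this.
[cite: ShimuraIATAF1971, §2.4 and Thm. 7.14] [cite: DiamondShurman2005, §1.2] [folklore]
-/

set_option autoImplicit false
-- lint-debt: the directory name repeats the summit name (sibling precedent `ManinLocalTwoThreeCDivisionNodesOneToFive.lean`)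
set_option linter.dupNamespace false

noncomputable section

open scoped MatrixGroups ModularForm PeriodPair Manifold Topology
open CongruenceSubgroup Complex Filter Asymptotics
open UpperHalfPlane hiding I
open WeierstrassCurve Literature.NumberTheory.EllipticCurves Literature.NumberTheory.EllipticCurves.ModularForms

namespace Summit.BirchSwinnertonDyer.BirchSwinnertonDyer.Theorems.ManinLocalTwoThree.CDivisionUDC

variable {N : ℕ} [NeZero N]

omit [NeZero N] in
/-- Slash bookkeeping high in the cusp `r·i∞`: if `F = ℘_Λ(E_f)·(12·B_d·Δ^a)` off the poles, `E_f(r·τ) = C + V(τ)` and `E_f(r·τ) ∉ Λ`, then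
`(F ∣[w+12a] r)(τ) = ℘_Λ(C + V τ)·Δ(τ)^a·(12·(B_d ∣[w] r)(τ))` (`Δ(rτ) = (cτ+d)¹²Δ(τ)`). [folklore] -/
theorem slash_apply_eq_of_presentation (f : CuspForm (Gamma0 N) 2) (L : PeriodPair) {w : ℤ} (Bd : ModularForm (Gamma0 N) w) (a : ℕ)
    (F : ℍ → ℂ) (hFeq : ∀ τ : ℍ, eichlerIntegral f τ ∉ L.lattice →
      F τ = ℘[L] (eichlerIntegral f τ) * ((12 : ℂ) * Bd τ * ModularForm.discriminant τ ^ a))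
    (r : SL(2, ℤ)) {C : ℂ} {V : ℍ → ℂ} (hC : ∀ τ : ℍ, eichlerIntegral f (r • τ) = C + V τ)
    (τ : ℍ) (hτ : eichlerIntegral f (r • τ) ∉ L.lattice) :
    (F ∣[w + 12 * (a : ℤ)] r) τ =
      ℘[L] (C + V τ) * ModularForm.discriminant τ ^ a * ((12 : ℂ) * (((Bd : ℍ → ℂ)) ∣[w] r) τ) := by
  have hd : denom (r : SL(2, ℤ)) τ ≠ 0 := denom_ne_zero r τ
  rw [ModularForm.SL_slash_apply, hFeq (r • τ) hτ, hC τ, ModularForm.SL_slash_apply, discriminant_apply_smul]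
  have e1 : (denom (r : SL(2, ℤ)) τ ^ (12 : ℤ) * ModularForm.discriminant τ) ^ a =
      denom (r : SL(2, ℤ)) τ ^ ((12 * a : ℕ) : ℤ) * ModularForm.discriminant τ ^ a := by
    rw [mul_pow, ← zpow_natCast (denom (r : SL(2, ℤ)) τ ^ (12 : ℤ)) a, ← zpow_mul]; norm_cast
  have e2 : denom (r : SL(2, ℤ)) τ ^ (-(w + 12 * (a : ℤ))) =
      denom (r : SL(2, ℤ)) τ ^ (-w) * (denom (r : SL(2, ℤ)) τ ^ ((12 * a : ℕ) : ℤ))⁻¹ := by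
    rw [neg_add, zpow_add₀ hd, ← zpow_neg]; push_cast; ring_nf
  have hD : denom (r : SL(2, ℤ)) τ ^ ((12 * a : ℕ) : ℤ) ≠ 0 := zpow_ne_zero _ hd
  rw [e1, e2]
  field_simp

/-- **(N6) in RAW form: growth at every cusp.**  For `f ≠ 0` in `S₂(Γ₀(N))`, a period pair `Λ`, `B_d ∈ M_w(Γ₀(N))` and a finite-index `Γ ≤ SL₂(ℤ)` there is
`a ≥ 2` such that every weight-`(w+12a)` `Γ`-invariant `F : ℍ → ℂ` equal to `℘_Λ(E_f)·(12·B_d·Δ^a)` off the poles has at most exponential growth high in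
every cusp: `‖(F ∣[w+12a] g)(τ)‖ ≤ C·e^{m·Im τ}` for `Im τ ≥ A` (indeed `F ∣ g → 0`).  No datum, no level hypothesis on `Γ`.
[cite: ShimuraIATAF1971, §2.4 and Thm. 7.14] -/
theorem growth_raw (f : CuspForm (Gamma0 N) 2) (hf : f ≠ 0) (L : PeriodPair) {w : ℤ} (Bd : ModularForm (Gamma0 N) w)
    (Γ : Subgroup SL(2, ℤ)) [Γ.FiniteIndex] :
    ∃ a : ℕ, 2 ≤ a ∧ ∀ F : ℍ → ℂ, (∀ γ ∈ Γ, F ∣[w + 12 * (a : ℤ)] γ = F) →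
      (∀ τ : ℍ, eichlerIntegral f τ ∉ L.lattice →
        F τ = ℘[L] (eichlerIntegral f τ) * ((12 : ℂ) * Bd τ * ModularForm.discriminant τ ^ a)) →
      ∀ g : SL(2, ℤ), ∃ C A m : ℝ, ∀ τ : ℍ, A ≤ τ.im → ‖(F ∣[w + 12 * (a : ℤ)] g) τ‖ ≤ C * Real.exp (m * τ.im) := by
  classical
  obtain ⟨R, hR⟩ := exists_finset_mul_cover Γ
  let mr : SL(2, ℤ) → ℕ := fun r ↦ analyticOrderNatAt (cuspFunction N (verticalIntegral (⇑f ∣[(2 : ℤ)] r))) 0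
  refine ⟨2 + ∑ r ∈ R, (2 * mr r + 1), by omega, ?_⟩
  intro F hFinv hFeq g
  obtain ⟨γ, hγ, r, hr, rfl⟩ := hR g
  have har : 2 * mr r + 1 ≤ 2 + ∑ r ∈ R, (2 * mr r + 1) :=
    (Finset.single_le_sum (f := fun r ↦ 2 * mr r + 1) (fun _ _ ↦ Nat.zero_le _) hr).trans (Nat.le_add_left _ _)
  set a : ℕ := 2 + ∑ r ∈ R, (2 * mr r + 1) with ha
  -- `F ∣ (γ r) = F ∣ r`
  have hslash : F ∣[w + 12 * (a : ℤ)] (γ * r) = F ∣[w + 12 * (a : ℤ)] r := by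
    rw [SlashAction.slash_mul, hFinv γ hγ]
  -- the cusp `r·i∞`
  obtain ⟨C, hC⟩ := exists_eichlerIntegral_smul_eq f r
  obtain ⟨T, hT⟩ := exists_forall_eichlerIntegral_smul_notMem f hf L r
  have hV := isCuspFunction_verticalIntegral_slash f r
  have hV0 := verticalIntegral_slash_ne_zero f hf r
  have hlim : Tendsto (fun τ : ℍ ↦ ℘[L] (C + verticalIntegral (⇑f ∣[(2 : ℤ)] r) τ) * ModularForm.discriminant τ ^ a)
      atImInfty (𝓝 0) :=
    hV.tendsto_weierstrassP_mul_pow_atImInfty hV0 isCuspFunction_discriminant L C har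
  -- `12·(B_d ∣ r)` is bounded at `i∞`
  have hBd : IsBoundedAtImInfty (fun τ : ℍ ↦ (12 : ℂ) * (((Bd : ℍ → ℂ)) ∣[w] r) τ) :=
    (const_boundedAtFilter atImInfty (12 : ℂ)).mul (ModularFormClass.bdd_at_infty_slash Bd r)
  obtain ⟨M, A₀, hM⟩ := isBoundedAtImInfty_iff.mp hBd
  have hBd' : IsBoundedUnder (· ≤ ·) atImInfty (fun τ : ℍ ↦ ‖(12 : ℂ) * (((Bd : ℍ → ℂ)) ∣[w] r) τ‖) :=
    ⟨M, (atImInfty_mem _).mpr ⟨A₀, fun z hz ↦ hM z hz⟩⟩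
  have hprod : Tendsto (fun τ : ℍ ↦ ℘[L] (C + verticalIntegral (⇑f ∣[(2 : ℤ)] r) τ) * ModularForm.discriminant τ ^ a *
      ((12 : ℂ) * (((Bd : ℍ → ℂ)) ∣[w] r) τ)) atImInfty (𝓝 0) :=
    hlim.zero_mul_isBoundedUnder_le hBd'
  have hmem : {τ : ℍ | T ≤ τ.im} ∈ atImInfty := (atImInfty_mem _).mpr ⟨T, fun _ h ↦ h⟩
  have hzero : IsZeroAtImInfty (F ∣[w + 12 * (a : ℤ)] r) := by
    refine (hprod.congr' ?_ : Tendsto (F ∣[w + 12 * (a : ℤ)] r) atImInfty (𝓝 0))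
    filter_upwards [hmem] with τ hτ
    exact (slash_apply_eq_of_presentation f L Bd a F hFeq r hC τ (hT τ hτ)).symm
  obtain ⟨A, hA⟩ := (isZeroAtImInfty_iff.mp hzero) 1 one_pos
  refine ⟨1, A, 0, fun τ hτ ↦ ?_⟩
  rw [hslash, zero_mul, Real.exp_zero, mul_one]
  exact hA τ hτ

/-- **The same node for an `X₁(N)`-datum** (`f = D₁.f`, `Λ = Λ_{W₁}`) — the growth clause of the `Γ₁` twin of E-an-242 needed for `|c₁| = 1`
(`CDivisionUDC.abs_maninConstant₁_eq_one_of_CDT_of_cDivisionWitnessLaw₁`). [cite: ShimuraIATAF1971, §2.4 and Thm. 7.14] -/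
theorem cDivGrowth₁_holds :
    ∀ (W : WeierstrassCurve ℚ) [W.IsElliptic] [W.IsGloballyMinimal] {N : ℕ} [NeZero N] (D : Gamma1ParametrizationData W N)
      (w : ℤ) (Bd : ModularForm (Gamma0 N) w) (Γ : Subgroup SL(2, ℤ)), Γ.FiniteIndex →
      ∃ a : ℕ, 2 ≤ a ∧ ∀ F : ℍ → ℂ, (∀ γ ∈ Γ, F ∣[w + 12 * (a : ℤ)] γ = F) →
        (∀ τ : ℍ, eichlerIntegral D.f τ ∉ D.L.lattice →
          F τ = ℘[D.L] (eichlerIntegral D.f τ) * ((12 : ℂ) * Bd τ * ModularForm.discriminant τ ^ a)) →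
        ∀ g : SL(2, ℤ), ∃ C A m : ℝ, ∀ τ : ℍ, A ≤ τ.im → ‖(F ∣[w + 12 * (a : ℤ)] g) τ‖ ≤ C * Real.exp (m * τ.im) := by
  intro W _ _ N _ D w Bd Γ hfi
  haveI := hfi
  exact growth_raw D.f D.isNewformOf.1.ne_zero D.L Bd Γ

end Summit.BirchSwinnertonDyer.BirchSwinnertonDyer.Theorems.ManinLocalTwoThree.CDivisionUDC

end
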